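import Summits.Ventures.CertifiedManyBodySolver.Downfold.PhaseMapMaterialVerdict
import Summits.Ventures.CertifiedManyBodySolver.Downfold.PhaseMapTablePooling
import HarnessLib

/-!
# §4.5 differentiation, decided fraction and the §4.5b honest flag as tallies: «undetermined everywhere cannot pass»,
# abstention is FP-safe but floor-costly, and the flag moves a floor without touching differentiation

Venture CertifiedManyBodySolver, cell `pub/hubbard-downfold`, seat hubbard-downfold-score-1 (second scoring engine);
namespace `Summit.Ventures.CertifiedManyBodySolver.Downfold.CellScore`. ACCEPTANCE §4.5 (differentiation = (TP + TN)/(TP + TN +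
FP + FN) over DECIDED materials; decided fraction = decided/all; FP named), §4.5b (HONEST FLAG: on `control-not-replicated` /
`control-retracted` a CODED, router-agreed, curated-disputed ABSTAIN counts toward the decided-fraction FLOOR as «flagged», never
toward differentiation), §7 (PASS needs differentiation = 1.00 with FP = 0, and decided fraction ≥ 0.90 on {conventional, hydride,
doped-covalent, control-*}, ≥ 0.60 on {cuprate, nickelate}, no floor elsewhere — «abstention is capped so that undetermined everywhere
cannot pass»). It REUSES `CellScore.Kind` (PhaseMapMaterialVerdict, p465336) and `CellScore.Tally`/`Tally.meets` (PhaseMapTablePooling,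
p478346). Everything here is PROVED (list induction + linear arithmetic).

WHAT THIS IS NOT: a verdict about any material or run; both engines compute these tallies as written. It is the KERNEL REFERENCE
for four sentences of the text:

* §1 counts `nKind k ks` over a class's list of material kinds, `decided`, `differentiation` (a `Tally`), `decidedFraction`,
  `decidedOrFlagged f` (§4.5b: `f` flagged abstentions added to the numerator only); `count_total` (the five kinds partition the
  list).
* §2 «DIFFERENTIATION = 1.00 WITH FP = 0»: `differentiation_meets_one_iff` — for a class with something decided, the clause holds
  iff FP = 0 ∧ FN = 0 (so «with FP = 0» is implied, and stated because an FP is always named); `nFP_eq_zero_of_forall` (the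
  table-level form of the FP guard `kind_ne_FP_of_noSC`: if no material's map says SC wrongly, the FP column is empty).
* §3 ABSTENTION: `abstain_nFP_le` / `abstain_decided_le` / `abstain_length` — replacing any one material's kind by ABSTAIN never
  adds an FP (honest abstention is SAFE for the hard part of the clause) but never raises the decided count (it is COSTLY for the
  floors); `decidedFraction_all_abstain` + `all_abstain_fails_floor`: a class where every material abstains has decided fraction
  0/n, which FAILS every positive floor — «undetermined everywhere cannot pass» — while a class WITHOUT a floor is untouched (the
  §13 honesty test scores its ROUTER word instead, §4.2).
* §4 THE HONEST FLAG: `decidedOrFlagged_meets_of_meets` (flags only ever help a floor), `differentiation_ignores_flags` (by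
  construction the flag never enters differentiation or the FP count), `flag_carries_singleton_class`: on a one-material class
  (LK-99, C–S–H) the coded abstention alone meets the 0.90 floor (1/1) where the bare abstention fails it (0/1) — exactly the
  §4.5b trilemma resolution.
* §5 numbers of record (run #5 = maps run-2026-08-26e, v1 table, both engines): TP 2 (M02 Pb, M03 Nb) · TN 1 (M13) · FP 0 · FN 0 ·
  ABSTAIN 56 ⇒ differentiation 3/3 meets 1.00; decided-fraction floors conventional 2/7 = 0.286 < 0.90 FAIL, cuprate 1/19 = 0.053 <
  0.60 FAIL, control-not-replicated (LK-99) 0 + flag 1 / 1 and control-retracted (C–S–H) 0 + flag 1 / 1 MEET 0.90 ⇒ §7 prints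
  INCOMPLETE(failing: decided-fraction-floors, …) — by kernel below.
-/

namespace Summit.Ventures.CertifiedManyBodySolver.Downfold

namespace CellScore

/-! ## §1 Counts and tallies over one class -/

/-- number of materials of kind `k` in a class's list. [folklore] -/
def nKind (k : Kind) : List Kind → ℕ
  | [] => 0
  | x :: xs => (if x = k then 1 else 0) + nKind k xs

/-- decided materials = TP + TN + FP + FN. [folklore] -/
def decided (ks : List Kind) : ℕ := nKind .TP ks + nKind .TN ks + nKind .FP ks + nKind .FN ks

/-- §4.5 differentiation as a tally: (TP + TN) out of decided. [folklore] -/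
def differentiation (ks : List Kind) : Tally := ⟨nKind .TP ks + nKind .TN ks, decided ks⟩

/-- §4.5 decided fraction as a tally: decided out of all materials of the class. [folklore] -/
def decidedFraction (ks : List Kind) : Tally := ⟨decided ks, ks.length⟩

/-- §4.5b: decided-or-honestly-flagged fraction — `f` coded abstentions (the scorer establishes conditions (i)–(iv)) are added to
the NUMERATOR of the floor tally only. [folklore] -/
def decidedOrFlagged (f : ℕ) (ks : List Kind) : Tally := ⟨decided ks + f, ks.length⟩

/-- `nKind` on a cons. [folklore] -/
theorem nKind_cons (k x : Kind) (xs : List Kind) : nKind k (x :: xs) = (if x = k then 1 else 0) + nKind k xs := rfl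

/-- The five kinds partition a class: TP + TN + FP + FN + ABSTAIN = number of materials. [folklore] -/
theorem count_total (ks : List Kind) : decided ks + nKind .ABSTAIN ks = ks.length := by
  induction ks with
  | nil => simp [decided, nKind]
  | cons x xs ih =>
    simp only [decided, nKind_cons, List.length_cons] at ih ⊢
    cases x <;> simp <;> omega

/-- Hence decided ≤ all (the decided fraction is a fraction). [folklore] -/
theorem decided_le_length (ks : List Kind) : decided ks ≤ ks.length := by
  have := count_total ks; omega

/-! ## §2 «differentiation = 1.00 with FP = 0» -/

/-- For a class with at least one decided material, the differentiation tally meets 1 iff there is no FP and no FN. (With nothing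
decided the clause is NA — `Tally.applicable` false.) [folklore] -/
theorem differentiation_meets_one_iff (ks : List Kind) (_h : 0 < decided ks) :
    (differentiation ks).meets 1 = true ↔ nKind .FP ks = 0 ∧ nKind .FN ks = 0 := by
  rw [Tally.meets_eq_true_iff]
  simp only [differentiation, decided, Nat.cast_add, one_mul]
  constructor
  · intro h
    have h' : ((nKind .FP ks + nKind .FN ks : ℕ) : ℚ) ≤ 0 := by push_cast; linarith
    have h'' : nKind .FP ks + nKind .FN ks ≤ 0 := by exact_mod_cast h'
    omega
  · rintro ⟨hFP, hFN⟩
    simp [hFP, hFN]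

/-- Table-level FP guard: if no material of the class has kind FP (per material: `kind_ne_FP_of_noSC` — a map with no SC cell and no
band lo ≥ 0.1 K is never an FP), the FP count is 0. [folklore] -/
theorem nFP_eq_zero_of_forall (ks : List Kind) (h : ∀ k ∈ ks, k ≠ .FP) : nKind .FP ks = 0 := by
  induction ks with
  | nil => rfl
  | cons x xs ih =>
    simp only [nKind_cons]
    have hx : x ≠ .FP := h x (by simp)
    simp [hx, ih (fun k hk => h k (by simp [hk]))]

/-- Conversely an FP anywhere makes the count positive (it is «always named»). [folklore] -/
theorem nFP_pos_of_mem (ks : List Kind) (h : Kind.FP ∈ ks) : 0 < nKind .FP ks := by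
  induction ks with
  | nil => simp at h
  | cons x xs ih =>
    simp only [nKind_cons]
    rcases List.mem_cons.mp h with rfl | hm
    · simp
    · have := ih hm; omega

/-! ## §3 Abstention: safe for the FP guard, costly for the floors; «undetermined everywhere cannot pass» -/

/-- Abstaining on one material never ADDS a false positive … [folklore] -/
theorem abstain_nFP_le (k : Kind) (ks : List Kind) : nKind .FP (.ABSTAIN :: ks) ≤ nKind .FP (k :: ks) := by
  simp only [nKind_cons]; cases k <;> simp

/-- … and removes one if that material WAS the false positive (the only way to clear an FP short of getting it right). [folklore] -/
theorem abstain_clears_FP (ks : List Kind) : nKind .FP (.ABSTAIN :: ks) + 1 = nKind .FP (.FP :: ks) := by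
  simp [nKind_cons]; omega

/-- … but never raises the decided count … [folklore] -/
theorem abstain_decided_le (k : Kind) (ks : List Kind) : decided (.ABSTAIN :: ks) ≤ decided (k :: ks) := by
  simp only [decided, nKind_cons]; cases k <;> simp

/-- … over the same number of materials, so the decided fraction can only drop. [folklore] -/
theorem abstain_length (k : Kind) (ks : List Kind) : (Kind.ABSTAIN :: ks).length = (k :: ks).length := by simp

/-- A class in which EVERY material abstains has decided count 0 … [folklore] -/
theorem decided_all_abstain (ks : List Kind) (h : ∀ k ∈ ks, k = .ABSTAIN) : decided ks = 0 := by
  induction ks with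
  | nil => rfl
  | cons x xs ih =>
    have hx : x = .ABSTAIN := h x (by simp)
    subst hx
    have := ih (fun k hk => h k (by simp [hk]))
    simp only [decided, nKind_cons] at this ⊢
    simpa using this

/-- … so its decided-fraction tally is 0 / n. [folklore] -/
theorem decidedFraction_all_abstain (ks : List Kind) (h : ∀ k ∈ ks, k = .ABSTAIN) :
    decidedFraction ks = ⟨0, ks.length⟩ := by
  simp [decidedFraction, decided_all_abstain ks h]

/-- «UNDETERMINED EVERYWHERE CANNOT PASS»: a NONEMPTY class in which every material abstains FAILS every positive floor. [folklore] -/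
theorem all_abstain_fails_floor (ks : List Kind) (hne : ks ≠ []) (h : ∀ k ∈ ks, k = .ABSTAIN) (θ : ℚ) (hθ : 0 < θ) :
    (decidedFraction ks).meets θ = false := by
  rw [decidedFraction_all_abstain ks h, Tally.meets_eq_false_iff]
  have : 0 < ks.length := List.length_pos_iff.mpr hne
  have : (0 : ℚ) < ks.length := by exact_mod_cast this
  simp only [Nat.cast_zero]
  positivity

/-- Whereas a class WITHOUT a floor (pnictide, chalcogenide, heavy-fermion, organic, iridate, ruthenate) is not judged on this tally at
all — stated as: the floor-0 test holds for every class, abstaining or not (the honesty test there is the ROUTER word, §4.2). [folklore] -/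
theorem floor_zero_meets (ks : List Kind) : (decidedFraction ks).meets 0 = true := by
  rw [Tally.meets_eq_true_iff]; simp

/-! ## §4 The honest flag (§4.5b) -/

/-- Flags only ever HELP a floor: if the bare decided fraction meets θ, so does decided-or-flagged (any f). [folklore] -/
theorem decidedOrFlagged_meets_of_meets (f : ℕ) (ks : List Kind) (θ : ℚ)
    (h : (decidedFraction ks).meets θ = true) : (decidedOrFlagged f ks).meets θ = true := by
  rw [Tally.meets_eq_true_iff] at h ⊢
  simp only [decidedFraction, decidedOrFlagged, Nat.cast_add] at h ⊢
  have : (0 : ℚ) ≤ f := by exact_mod_cast Nat.zero_le f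
  linarith

/-- With no flag the two tallies coincide. [folklore] -/
theorem decidedOrFlagged_zero (ks : List Kind) : decidedOrFlagged 0 ks = decidedFraction ks := by
  simp [decidedOrFlagged, decidedFraction]

/-- BY CONSTRUCTION the flag never enters differentiation (nor the FP count): both are functions of the kinds alone. Stated as the
(trivial but load-bearing) fact that differentiation does not mention `f`. [folklore] -/
theorem differentiation_ignores_flags (f : ℕ) (ks : List Kind) :
    differentiation ks = ⟨nKind .TP ks + nKind .TN ks, (decidedOrFlagged f ks).num - f⟩ := by
  simp [differentiation, decidedOrFlagged]

/-- THE TRILEMMA RESOLVED on a one-material class (LK-99 alone in `control-not-replicated`, C–S–H alone in `control-retracted`): the bare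
abstention reads 0/1 and FAILS the 0.90 floor; the coded, router-agreed, curated-disputed abstention reads (0 + 1)/1 and MEETS it —
and neither touches differentiation or could ever be an FP. [folklore] -/
theorem flag_carries_singleton_class :
    (decidedFraction [Kind.ABSTAIN]).meets (9 / 10) = false ∧ (decidedOrFlagged 1 [Kind.ABSTAIN]).meets (9 / 10) = true ∧
      nKind .FP [Kind.ABSTAIN] = 0 := by
  have h0 : decidedFraction [Kind.ABSTAIN] = ⟨0, 1⟩ := by decide
  have h1 : decidedOrFlagged 1 [Kind.ABSTAIN] = ⟨1, 1⟩ := by decide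
  refine ⟨?_, ?_, by decide⟩
  · rw [h0, Tally.meets_eq_false_iff]; norm_num
  · rw [h1, Tally.meets_eq_true_iff]; norm_num

/-! ## §5 Numbers of record: run #5 (maps run-2026-08-26e), VALIDATION-SET v1 table, both engines -/

/-- The v1 table's kinds in material order are 2 TP, 1 TN, 56 ABSTAIN (59 materials). [folklore] -/
def run5v1 : List Kind := [Kind.TP, Kind.TP, Kind.TN] ++ List.replicate 56 Kind.ABSTAIN

/-- Differentiation 3/3: meets 1.00 (FP 0, FN 0), decided 3 of 59. [folklore] -/
theorem run5v1_differentiation :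
    differentiation run5v1 = ⟨3, 3⟩ ∧ (differentiation run5v1).meets 1 = true ∧ decidedFraction run5v1 = ⟨3, 59⟩ := by
  have hd : differentiation run5v1 = ⟨3, 3⟩ := by decide
  have hf : decidedFraction run5v1 = ⟨3, 59⟩ := by decide
  refine ⟨hd, ?_, hf⟩
  rw [hd, Tally.meets_eq_true_iff]; norm_num

/-- Decided-fraction floors of record: conventional 2/7 FAILS 0.90, cuprate 1/19 FAILS 0.60 — two of the reasons the §7 line reads
INCOMPLETE(failing: decided-fraction-floors, …). [folklore] -/
theorem run5v1_class_floors_fail :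
    (Tally.mk 2 7).meets (9 / 10) = false ∧ (Tally.mk 1 19).meets (3 / 5) = false := by
  constructor <;> (rw [Tally.meets_eq_false_iff]; norm_num)

/-- … while the two single-material control classes are carried by the honest flag: (0 + 1)/1 meets 0.90 for LK-99 (M30) and for
C–S–H (M31) (honest-flag M30/M31/M52c in both engines' lines; M52c's class has no floor). [folklore] -/
theorem run5v1_controls_flagged : (decidedOrFlagged 1 [Kind.ABSTAIN]).meets (9 / 10) = true :=
  flag_carries_singleton_class.2.1

/-! ## §6 (appended g4) READING R44 (director-hubbard R-2, 2026-08-27T01:30:54Z; ACCEPTANCE v1.7): named un-instrumented members leave a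
floored class's DENOMINATOR — it can only help a floor, and it cannot manufacture a PASS out of an all-abstaining class -/

/-- Shrinking a tally's denominator (R44: exempt members leave it; the numerator — decided or flagged — is untouched) never turns a met floor into
a missed one, for any non-negative floor. [folklore] -/
theorem meets_of_den_le (θ : ℚ) (hθ : 0 ≤ θ) (k n n' : ℕ) (hle : n' ≤ n) (h : (Tally.mk k n).meets θ = true) :
    (Tally.mk k n').meets θ = true := by
  rw [Tally.meets_eq_true_iff] at h ⊢
  have : (n' : ℚ) ≤ n := by exact_mod_cast hle
  simp only at h ⊢
  nlinarith

/-- … and the exemption cannot manufacture a PASS: with NOTHING decided or flagged, any class that still has a non-exempt member fails every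
positive floor (guardrail (b): «no threshold, numerator rule or class floor value changes»). [folklore] -/
theorem exempt_all_abstain_fails (n' : ℕ) (hn : 0 < n') (θ : ℚ) (hθ : 0 < θ) : (Tally.mk 0 n').meets θ = false := by
  rw [Tally.meets_eq_false_iff]
  have : (0 : ℚ) < n' := by exact_mod_cast hn
  simp only [Nat.cast_zero]
  positivity

/-- R44 re-render of RUN #6 for information (director (d)): control-nonSC 0 decided of 4 − 1 exempt (M49) = 0/3 FAILS 0.90 and needs 3/3;
nickelate 0 of 7 − 3 exempt (M23, M24, M40) = 0/4 FAILS 0.60 and first passes at 3/4 (2/4 fails) — «today's outcome is unchanged either way».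
[folklore] -/
theorem run6_r44_rerender :
    (Tally.mk 0 3).meets (9 / 10) = false ∧ (Tally.mk 3 3).meets (9 / 10) = true ∧ (Tally.mk 2 3).meets (9 / 10) = false ∧
      (Tally.mk 0 4).meets (3 / 5) = false ∧ (Tally.mk 2 4).meets (3 / 5) = false ∧ (Tally.mk 3 4).meets (3 / 5) = true := by
  refine ⟨?_, ?_, ?_, ?_, ?_, ?_⟩ <;>
    first
    | exact (Tally.meets_nine_tenths_iff _ _).mpr (by norm_num)
    | exact (Tally.meets_three_fifths_iff _ _).mpr (by norm_num)
    | exact (Bool.eq_false_iff).mpr (fun h => absurd ((Tally.meets_nine_tenths_iff _ _).mp h) (by norm_num))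
    | exact (Bool.eq_false_iff).mpr (fun h => absurd ((Tally.meets_three_fifths_iff _ _).mp h) (by norm_num))

/-! ## §7 (appended 2026-08-27 g6) DECIDABILITY CEILING (FINDING F22): UND-primary members abstain by construction, so a floored class
can reach at most (non-exempt − UND-primary) / non-exempt — and when that ceiling is below the floor NO stage output passes the clause

ACCEPTANCE §3.3 R-2W(a)/(c) + the assembler precedence (oracle-dag FORMAT l.53; deputy-2 Q19 reading (a) confirmed 2026-08-27T04:31Z): a material
whose PRIMARY router word is UND:<x> has every cell «undetermined (router:UND:…)» — kind ABSTAIN for either truth class (PhaseMapRouterPrimaryCells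
`kind_UND_primary`). With `b` such members among the `n` non-exempt members of a class, every admissible completion decides at most `n − b`, and the
floor test is monotone in the numerator, so `⟨n − b, n⟩` failing θ means EVERY completion fails θ. RUN #12 (maps run-2026-08-27g, both engines):
v1 cuprate n = 19, b = 12 (M13 M14 M15 M16 M17 M19 M19b M20 M35 M37 M38 M50 UND:MIXED) ⇒ ceiling 7/19 fails 0.60 ⇒ UNREACHABLE; v2 hydride
n = 4, b = 2 ⇒ 2/4 fails 0.90 ⇒ UNREACHABLE; v2 cuprate n = 10, b = 4 ⇒ 6/10 meets 0.60 exactly (5/10 fails: needs all six). -/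

/-- Monotone numerator: if the BEST admissible completion ⟨c, n⟩ fails a non-negative floor, every completion ⟨k, n⟩ with k ≤ c fails it. [folklore] -/
theorem fails_of_le_ceiling (θ : ℚ) (c n k : ℕ) (hk : k ≤ c) (h : (Tally.mk c n).meets θ = false) :
    (Tally.mk k n).meets θ = false := by
  rw [Tally.meets_eq_false_iff] at h ⊢
  have : (k : ℚ) ≤ c := by exact_mod_cast hk
  simp only at h ⊢
  linarith

/-- The ceiling itself: `b` UND-primary members of `n` abstain by construction, so any completion decides some k ≤ n − b; if ⟨n − b, n⟩ fails θ
the clause is UNREACHABLE — it fails for every such k. [folklore] -/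
theorem unreachable_of_ceiling_fails (θ : ℚ) (n b : ℕ) (h : (Tally.mk (n - b) n).meets θ = false) :
    ∀ k, k ≤ n - b → (Tally.mk k n).meets θ = false :=
  fun k hk => fails_of_le_ceiling θ (n - b) n k hk h

/-- RUN #12 v1 CUPRATE: 19 non-exempt, 12 UND:MIXED ⇒ ceiling ⟨7, 19⟩ fails 0.60 (3·19 = 57 > 35 = 5·7) ⇒ every completion fails;
Q-CI-1 option (B) (M13 decided by the CI road) lifts the ceiling to 8/19, which still fails (57 > 40). [folklore] -/
theorem run12_v1_cuprate_unreachable :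
    (Tally.mk (19 - 12) 19).meets (3 / 5) = false ∧ (∀ k, k ≤ 19 - 12 → (Tally.mk k 19).meets (3 / 5) = false) ∧
      (Tally.mk 8 19).meets (3 / 5) = false := by
  have h7 : (Tally.mk (19 - 12) 19).meets (3 / 5) = false :=
    (Bool.eq_false_iff).mpr (fun h => absurd ((Tally.meets_three_fifths_iff _ _).mp h) (by norm_num))
  exact ⟨h7, unreachable_of_ceiling_fails _ 19 12 h7, (Bool.eq_false_iff).mpr (fun h => absurd ((Tally.meets_three_fifths_iff _ _).mp h) (by norm_num))⟩

/-- … and reachability returns exactly when the UND-primary count drops to 7 or fewer: ⟨12, 19⟩ meets 0.60 (57 ≤ 60), ⟨11, 19⟩ does not (57 > 55)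
— at least FIVE of the twelve UND:MIXED cuprates need a deciding primary before twelve decisions are even possible. [folklore] -/
theorem run12_v1_cuprate_reachable_iff_b_le_7 :
    (Tally.mk (19 - 7) 19).meets (3 / 5) = true ∧ (Tally.mk (19 - 8) 19).meets (3 / 5) = false := by
  constructor
  · exact (Tally.meets_three_fifths_iff _ _).mpr (by norm_num)
  · exact (Bool.eq_false_iff).mpr (fun h => absurd ((Tally.meets_three_fifths_iff _ _).mp h) (by norm_num))

/-- RUN #12 v2: HYDRIDE 4 non-exempt, 2 UND:MIXED (M67, M68) ⇒ ceiling ⟨2, 4⟩ fails 0.90 ⇒ UNREACHABLE; CUPRATE 10 non-exempt, 4 UND:MIXED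
(M53–M56) ⇒ ceiling ⟨6, 10⟩ meets 0.60 EXACTLY while ⟨5, 10⟩ fails — reachable only if all six decidable members are decided. [folklore] -/
theorem run12_v2_ceilings :
    (Tally.mk (4 - 2) 4).meets (9 / 10) = false ∧ (Tally.mk (10 - 4) 10).meets (3 / 5) = true ∧ (Tally.mk 5 10).meets (3 / 5) = false := by
  refine ⟨?_, ?_, ?_⟩
  · exact (Bool.eq_false_iff).mpr (fun h => absurd ((Tally.meets_nine_tenths_iff _ _).mp h) (by norm_num))
  · exact (Tally.meets_three_fifths_iff _ _).mpr (by norm_num)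
  · exact (Bool.eq_false_iff).mpr (fun h => absurd ((Tally.meets_three_fifths_iff _ _).mp h) (by norm_num))

end CellScore

end Summit.Ventures.CertifiedManyBodySolver.Downfold
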